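import Summits.BirchSwinnertonDyer.Rank1Residual.X11b.SelmerTorsionControl
import Literature.NumberTheory.GaloisRepresentations.ContinuousCohomologyAdditiveTransport
import Mathlib.Algebra.Module.CharacterModule
import HarnessLib

/-!
# Crux 4 `BSDpOnCellC` (stmt-BirchSwinnertonDyer-19034), line «telescope», leaf N2 sub-leaf W3 / leaf N3′ — SELMER GROUPS AND THEIR PONTRYAGIN DUALS
# DO NOT SEE THE RING OF SCALARS (successor LEAD `cruxlead-19034` g3; `--supports`, helper; THEOREMS ONLY)

HONEST FRAMING. Generic cohomological bookkeeping; no curve; proves no stub, no crux, no summit statement; BSD is proved for no curve.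
Third brick of the W3 transport (after `…TelescopeK2CohomologyTransfer` = bounded-torsion transfer over ONE coefficient ring, and
`…TelescopeK2BigRepTransfer` = the induced big-module map). THE PROBLEM IT SOLVES: in W3 (`K2Weight2.stub_weightTwoTransport`) the weight-two
Selmer dual `Y = Sel(K, M₂[C X])^∨` is typed as a module over `B = ℤ_p⟦X⟧⟦T⟧` with an auxiliary `Λ = ℤ_p⟦T⟧`-structure through the scalar
tower `Λ → B`, whereas the `E`-side `X^{unr}(E) = XBig κ (E[p^∞]) 𝔭̄ ∅` and the transfer bricks live over `Λ`; the two meet on modules that are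
identified only ADDITIVELY (same smooth functions `ℤ_p → A₂[X]`, scalars `B` vs `Λ`: the tree's `BigRep.torsionValuedEquiv` and
`BigRepModule.restrictScalarsEquiv`). This file proves, for any two discrete representations `ρ₁ : ContinuousRep Γ A₁ M₁`,
`ρ₂ : ContinuousRep Γ A₂ M₂` over TWO coefficient rings, identified by a `Γ`-equivariant continuous additive equivalence `η : M₁ ≃ₜ+ M₂` that is
SEMILINEAR along a ring map `σ : A₁ →+* A₂` (`η (r • m) = σ r • η m`):

* §1 **`exists_selmer_addEquiv`** — an additive equivalence `e : Sel_L(ρ₁) ≃+ Sel_L(ρ₂)` for every family of local maps `φ_v : Γ_v →ₜ* Γ` and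
  constrained set `L`, `σ`-SEMILINEAR (`e (r • s) = σ r • e s`); it is the tree's scalar-blind `continuousCohomologyAddEquiv η` restricted to the
  Selmer groups — the local conditions correspond by its naturality (`continuousCohomologyAddEquiv_map`) along the `φ_v`, and semilinearity is
  its naturality along the scalar endomorphisms (`TorsionControl.smulHom`, `cohomologyMap_smulHom_one`). Template: bsd-stepL's
  `ErratumRoadFiveTwoVariableControlHom.exists_controlHom` (the constants equivalence `M ≃ 𝓜[X]`).
* §2 **`nonempty_dual_linearEquiv`** — for `σ = algebraMap A₁ A₂` and ANY `A₁`-structure on `Sel_L(ρ₂)^∨` compatible with its `A₂`-structure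
  (`IsScalarTower A₁ A₂ _` — the shape of W3's binders `[Module Λ Y] [IsScalarTower Λ B Y]`): an `A₁`-LINEAR equivalence
  `Sel_L(ρ₂)^∨ ≃ₗ[A₁] Sel_L(ρ₁)^∨` (precomposition with `e`), so `Module.Finite`, `Module.IsTorsion` and `Module.charIdeal` over `A₁` transfer.

References: K. S. Brown, *Cohomology of Groups* (1982), III.1 Ex. 3 (the standard complex does not involve the scalars) [Brown1982CohomologyGroups];
J.-P. Serre, *Galois Cohomology* (1997), I §2.2–2.4 [SerreGaloisCohomology1997]; C. Skinner, Pacific J. Math. 283 (2016) §2.3 p. 179 (Selmer groups and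
change of coefficients) [Skinner2016PacificMC].
-/

noncomputable section

open CategoryTheory Literature.NumberTheory.GaloisRepresentations
open scoped ContRepresentation

universe u

set_option linter.dupNamespace false

namespace Summit.BirchSwinnertonDyer.BirchSwinnertonDyer.Theorems.TelescopeK2SelmerScalarTransport

open Summit.BirchSwinnertonDyer.Rank1Residual.X11b.TorsionControl

variable {A₁ : Type*} [CommRing A₁] [TopologicalSpace A₁] {A₂ : Type*} [CommRing A₂] [TopologicalSpace A₂]
variable {Γ : Type u} [Group Γ] [TopologicalSpace Γ] [IsTopologicalGroup Γ]
variable {M₁ : Type u} [AddCommGroup M₁] [Module A₁ M₁] [TopologicalSpace M₁] [DiscreteTopology M₁]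
  [ContinuousSMul A₁ M₁]
variable {M₂ : Type u} [AddCommGroup M₂] [Module A₂ M₂] [TopologicalSpace M₂] [DiscreteTopology M₂]
  [ContinuousSMul A₂ M₂]
variable {ι : Type*} {Γv : ι → Type u} [∀ v, Group (Γv v)] [∀ v, TopologicalSpace (Γv v)]
  [∀ v, IsTopologicalGroup (Γv v)] (φ : ∀ v, Γv v →ₜ* Γ) (L : Set ι)
  (ρ₁ : ContinuousRep Γ A₁ M₁) (ρ₂ : ContinuousRep Γ A₂ M₂)

/-! ## §1 Selmer groups along an equivariant additive identification of coefficients, across two scalar rings -/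

/-- **Selmer groups do not see the ring of scalars.** For a `Γ`-equivariant continuous additive equivalence `η : M₁ ≃ₜ+ M₂` between the modules
of two discrete representations over two coefficient rings, semilinear along `σ : A₁ →+* A₂`, the scalar-blind comparison `H¹(Γ, M₁) ≃+ H¹(Γ, M₂)`
(`continuousCohomologyAddEquiv η`) restricts to an additive equivalence of the Selmer groups cut out by ANY family of local maps and constrained set,
and it is `σ`-semilinear. [cite: Brown1982CohomologyGroups, III.1 Example 3] [cite: Skinner2016PacificMC, §2.3 (p. 179)] -/
theorem exists_selmer_addEquiv (σ : A₁ →+* A₂) (η : M₁ ≃ₜ+ M₂) (hη : ∀ (g : Γ) (m : M₁), η (ρ₁ g m) = ρ₂ g (η m))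
    (hησ : ∀ (r : A₁) (m : M₁), η (r • m) = σ r • η m) :
    ∃ e : selmer φ L ρ₁ ≃+ selmer φ L ρ₂,
      ∀ (r : A₁) (s : selmer φ L ρ₁), e (r • s) = σ r • e s := by
  -- the scalar-blind `H¹` comparison along `η`
  let E := continuousCohomologyAddEquiv (X := ρ₁.toTopRep) (Y := ρ₂.toTopRep) η hη 1
  -- naturality with the restrictions along `φ v`: local conditions correspond
  have hres : ∀ (v : ι) (x : continuousCohomology 1 ρ₁.toTopRep),
      resH1 ρ₁ (φ v) x = 0 ↔ resH1 ρ₂ (φ v) (E x) = 0 := by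
    intro v x
    let Ev := continuousCohomologyAddEquiv (X := (ρ₁.restrict (φ v)).toTopRep)
      (Y := (ρ₂.restrict (φ v)).toTopRep) η (fun h m => hη (φ v h) m) 1
    have hnat := continuousCohomologyAddEquiv_map (X := ρ₁.toTopRep) (X' := ρ₂.toTopRep)
      (Y := (ρ₁.restrict (φ v)).toTopRep) (Y' := (ρ₂.restrict (φ v)).toTopRep)
      η hη η (fun h m => hη (φ v h) m) (φ v) (resMod ρ₁ (φ v)) (resMod ρ₂ (φ v)) (fun _ => rfl) 1 x
    change (resH1 ρ₁ (φ v)).hom x = 0 ↔ (resH1 ρ₂ (φ v)).hom (E x) = 0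
    rw [← hnat]
    constructor
    · intro h0
      rw [h0, map_zero]
    · intro h0
      exact Ev.injective (by rw [h0, map_zero])
  -- naturality with the scalar endomorphisms: `E` is `σ`-semilinear
  have hE_smul : ∀ (r : A₁) (x : continuousCohomology 1 ρ₁.toTopRep), E (r • x) = σ r • E x := by
    intro r x
    have hnat := continuousCohomologyAddEquiv_map (X := ρ₁.toTopRep) (X' := ρ₂.toTopRep)
      (Y := ρ₁.toTopRep) (Y' := ρ₂.toTopRep) η hη η hη (ContinuousMonoidHom.id Γ)
      (resIdHom (smulHom ρ₁ r)) (resIdHom (smulHom ρ₂ (σ r))) (fun m => hησ r m) 1 x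
    rw [← cohomologyMap_smulHom_one ρ₁ r x, ← cohomologyMap_smulHom_one ρ₂ (σ r) (E x)]
    exact hnat
  -- the Selmer conditions correspond under `E`
  have hsel : ∀ x : continuousCohomology 1 ρ₁.toTopRep, x ∈ selmer φ L ρ₁ ↔ E x ∈ selmer φ L ρ₂ := by
    intro x
    rw [mem_selmer_iff, mem_selmer_iff]
    exact forall₂_congr fun v _ => hres v x
  have hsel' : ∀ y : continuousCohomology 1 ρ₂.toTopRep, y ∈ selmer φ L ρ₂ ↔ E.symm y ∈ selmer φ L ρ₁ := by
    intro y
    rw [hsel, E.apply_symm_apply]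
  let e : selmer φ L ρ₁ ≃+ selmer φ L ρ₂ :=
    { toFun := fun s => ⟨E s, (hsel s).1 s.2⟩
      invFun := fun t => ⟨E.symm t, (hsel' t).1 t.2⟩
      left_inv := fun s => Subtype.ext (E.symm_apply_apply _)
      right_inv := fun t => Subtype.ext (E.apply_symm_apply _)
      map_add' := fun s s' => Subtype.ext (by
        change E ((s : continuousCohomology 1 ρ₁.toTopRep) + s') = E s + E s'
        rw [map_add]) }
  refine ⟨e, fun r s => Subtype.ext ?_⟩
  change E (r • (s : continuousCohomology 1 ρ₁.toTopRep)) = σ r • E s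
  exact hE_smul r s

/-! ## §2 Pontryagin duals: an `A₁`-linear identification for any compatible `A₁`-structure on `Sel_L(ρ₂)^∨` -/

/-- **The Pontryagin duals of the two Selmer groups are `A₁`-linearly isomorphic** — for `σ = algebraMap A₁ A₂` and any `A₁`-module structure on
`Sel_L(ρ₂)^∨` compatible with its `A₂`-structure (scalar tower; in W3: `[Module Λ Y] [IsScalarTower Λ B Y]`): precomposition with the additive
equivalence of §1 is an `A₁`-LINEAR equivalence `Sel_L(ρ₂)^∨ ≃ₗ[A₁] Sel_L(ρ₁)^∨` (`(χ ∘ e)(r • s) = χ (σ r • e s) = (σ r • χ)(e s) = (r • χ)(e s)`).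
Consequently `Module.Finite A₁`, `Module.IsTorsion A₁` and `Module.charIdeal A₁` of `Sel_L(ρ₂)^∨` are those of `Sel_L(ρ₁)^∨`.
[cite: Brown1982CohomologyGroups, III.1 Example 3] [cite: Skinner2016PacificMC, §2.3 (p. 179)] -/
theorem nonempty_dual_linearEquiv [Algebra A₁ A₂] (η : M₁ ≃ₜ+ M₂) (hη : ∀ (g : Γ) (m : M₁), η (ρ₁ g m) = ρ₂ g (η m))
    (hησ : ∀ (r : A₁) (m : M₁), η (r • m) = algebraMap A₁ A₂ r • η m)
    [Module A₁ (CharacterModule (selmer φ L ρ₂))] [IsScalarTower A₁ A₂ (CharacterModule (selmer φ L ρ₂))] :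
    Nonempty (CharacterModule (selmer φ L ρ₂) ≃ₗ[A₁] CharacterModule (selmer φ L ρ₁)) := by
  obtain ⟨e, he⟩ := exists_selmer_addEquiv φ L ρ₁ ρ₂ (algebraMap A₁ A₂) η hη hησ
  let D : CharacterModule (selmer φ L ρ₂) ≃+ CharacterModule (selmer φ L ρ₁) :=
    { toFun := fun χ => χ.comp e.toAddMonoidHom
      invFun := fun ψ => ψ.comp e.symm.toAddMonoidHom
      left_inv := fun χ => by
        ext t
        change χ (e (e.symm t)) = χ t
        rw [e.apply_symm_apply]
      right_inv := fun ψ => by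
        ext s
        change ψ (e.symm (e s)) = ψ s
        rw [e.symm_apply_apply]
      map_add' := fun χ χ' => by ext s; rfl }
  have hD : ∀ (χ : CharacterModule (selmer φ L ρ₂)) (s : selmer φ L ρ₁), D χ s = χ (e s) := fun _ _ => rfl
  refine ⟨{ D with
    map_smul' := fun r χ => ?_ }⟩
  ext s
  change D (r • χ) s = (r • D χ) s
  rw [CharacterModule.smul_apply, hD, hD, ← IsScalarTower.algebraMap_smul A₂ r χ,
    CharacterModule.smul_apply, he]

end Summit.BirchSwinnertonDyer.BirchSwinnertonDyer.Theorems.TelescopeK2SelmerScalarTransport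

end
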